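import Summits.NavierStokesRegularity.NavierStokesRegularity.Theorems.LerayQuarterDissipationFiniteDissipationLiouvillePersistenceSeq
import Literature.Analysis.FluidPDE.OseenMildUniqueness
import HarnessLib

/-!
# Crux `FiniteDissipationLiouville` (stmt-NavierStokesRegularity-22144), calm-slice leaf, I:
# forward vanishing from a zero slice

Theorems file of route `LerayQuarterDissipation` (seat ns-lqd-p2 g4; `--supports` the crux; first
brick of the CALM-SLICE LEAF = the content of `OneCalmSlice`, item stmt-NavierStokesRegularity-24375
of the sister route `CalmSliceGate`). Navier–Stokes regularity is NOT proved here; no summit is.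

* `eq_zero_after_zero_slice` — **forward uniqueness from a zero slice**: a Type-I ancient mild
  field `w` (KNSS gauge) with `w(t₀, ·) = 0` for some `t₀ < 0` vanishes on `(t₀, 0) × ℝ³`.
  Proof: on `(t₀, t₁)`, `t₁ < 0`, both `w` and `0` are bounded (`C/√(−t₁)`) jointly measurable
  solutions of the Oseen integral equation with the free term `e^{(t−t₀)Δ} 0 = 0`, so they agree
  a.e. by the tree's `oseenMild_bounded_unique` (Koch–Nadirashvili–Seregin–Šverák 2009, §3–§4;
  Giga–Inui–Matsui 1999); slices are continuous, hence equal everywhere.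
* `not_singular_of_zero_slice` — consequently such a field is NOT singular at the apex in the
  route's sense (it is bounded by `0` on the backward cylinder `(−r², 0) × B(0, r)`, `r² ≤ −t₀`).

References: KNSS, Acta Math. 203 (2009) = arXiv:0709.3599, §3 p. 6, §4 p. 8.
-/

noncomputable section

-- the summit and its single sub-problem share the name (CONVENTIONS §1), as in every Theorems file
set_option linter.dupNamespace false

namespace Summit.NavierStokesRegularity.NavierStokesRegularity.Theorems.FiniteDissipationLiouville.CalmSlice

open MeasureTheory Set Filter Topology Metric Function
open Literature.Analysis Literature.Analysis.FluidPDE Literature.Analysis.UnboundedOperators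
open scoped ENNReal NNReal

/-- **Forward uniqueness from a zero slice.** If a Type-I ancient mild field `w` (KNSS gauge)
has `w t₀ x = 0` for all `x` at some time `t₀` (necessarily `t₀ < 0` for the conclusion to have
content), then `w t x = 0` for all `t ∈ (t₀, 0)` and all `x`: `w` and `0` solve the same Oseen integral equation from the zero datum and are bounded on
`(t₀, t₁) × ℝ³` for every `t₁ < 0` (uniqueness of bounded mild solutions, KNSS 2009 §4). [cite: KochNadirashviliSereginSverak2009, §4 (4.3)–(4.4) (arXiv:0709.3599 p. 8)] -/
theorem eq_zero_after_zero_slice {C : ℝ}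
    {w : ℝ → EuclideanSpace ℝ (Fin 3) → EuclideanSpace ℝ (Fin 3)}
    (hw : IsTypeIAncientMild C w) {t₀ : ℝ} (h0 : ∀ x, w t₀ x = 0)
    {t : ℝ} (ht : t ∈ Ioo t₀ 0) (x : EuclideanSpace ℝ (Fin 3)) : w t x = 0 := by
  -- work on the window `(t₀, t₁)` with `t < t₁ < 0`
  set t₁ : ℝ := t / 2 with ht₁
  have ht₁0 : t₁ < 0 := by rw [ht₁]; linarith [ht.2]
  have htt₁ : t < t₁ := by rw [ht₁]; linarith [ht.2]
  have hM : 0 ≤ C / Real.sqrt (-t₁) := div_nonneg hw.nonneg (Real.sqrt_nonneg _)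
  have h0f : w t₀ = fun _ => (0 : EuclideanSpace ℝ (Fin 3)) := funext h0
  -- the free term from the zero datum vanishes
  have hfree : ∀ s ∈ Ioo t₀ t₁, ∀ y, heatFlow (w t₀) (s - t₀) y = 0 := by
    intro s hs y
    rw [heatFlow_of_pos _ (sub_pos.2 hs.1), h0f, heatExtension_const _ (sub_pos.2 hs.1)]
  -- `w` solves the equation with zero free term
  have hu : ∀ s ∈ Ioo t₀ t₁, w s =ᵐ[volume]
      fun y => (0 : ℝ → EuclideanSpace ℝ (Fin 3) → EuclideanSpace ℝ (Fin 3)) s y -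
        oseenDuhamel 1 t₀ w w s y := by
    intro s hs
    refine Eventually.of_forall fun y => ?_
    have := hw.mild_eq hs.1 (hs.2.trans ht₁0) y
    rw [hfree s hs y] at this
    simpa using this
  -- `0` solves it too
  have hv : ∀ s ∈ Ioo t₀ t₁, (0 : ℝ → EuclideanSpace ℝ (Fin 3) → EuclideanSpace ℝ (Fin 3)) s
      =ᵐ[volume] fun y => (0 : ℝ → EuclideanSpace ℝ (Fin 3) → EuclideanSpace ℝ (Fin 3)) s y -
        oseenDuhamel 1 t₀ (0 : ℝ → EuclideanSpace ℝ (Fin 3) → EuclideanSpace ℝ (Fin 3)) 0 s y := by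
    intro s hs
    refine Eventually.of_forall fun y => ?_
    simp
  have hzm : AEStronglyMeasurable
      (uncurry (0 : ℝ → EuclideanSpace ℝ (Fin 3) → EuclideanSpace ℝ (Fin 3)))
      ((volume : Measure (ℝ × EuclideanSpace ℝ (Fin 3))).restrict (Ioo t₀ t₁ ×ˢ univ)) :=
    aestronglyMeasurable_const
  have huniq := oseenMild_bounded_unique (E := EuclideanSpace ℝ (Fin 3)) (ν := 1) (u := w)
    (v := (0 : ℝ → EuclideanSpace ℝ (Fin 3) → EuclideanSpace ℝ (Fin 3))) one_pos hM
    (hw.aestronglyMeasurable_uncurry (s := t₀) ht₁0.le) hzm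
    (fun τ hτ y => hw.norm_le_of_mem_Ioo ht₁0 hτ y)
    (fun τ _ y => by simp only [Pi.zero_apply, norm_zero]; exact hM) hu hv t ⟨ht.1, htt₁⟩
  -- continuous slices: a.e. equality is equality
  have hcont : Continuous (w t) := hw.continuous_slice ht.2
  have heq : w t = (0 : ℝ → EuclideanSpace ℝ (Fin 3) → EuclideanSpace ℝ (Fin 3)) t :=
    (Continuous.ae_eq_iff_eq volume hcont continuous_const).1 huniq
  simpa using congrFun heq x

/-- **A member with a zero slice is not singular at the apex**: if `w t₀ = 0` for some `t₀ < 0`,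
then `w` does NOT exceed every bound on every backward cylinder `(−r², 0) × B(0, r)` (take
`r = min 1 √(−t₀)` and the bound `0`). [cite: KochNadirashviliSereginSverak2009, §4 (arXiv:0709.3599 p. 8)] -/
theorem not_singular_of_zero_slice {C : ℝ}
    {w : ℝ → EuclideanSpace ℝ (Fin 3) → EuclideanSpace ℝ (Fin 3)}
    (hw : IsTypeIAncientMild C w) {t₀ : ℝ} (ht₀ : t₀ < 0) (h0 : ∀ x, w t₀ x = 0) :
    ¬ (∀ r > 0, ∀ M : ℝ, ∃ t ∈ Ioo (-(r ^ 2)) (0 : ℝ),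
      ∃ x ∈ ball (0 : EuclideanSpace ℝ (Fin 3)) r, M < ‖w t x‖) := by
  intro hsing
  set r : ℝ := min 1 (Real.sqrt (-t₀)) with hr
  have hrpos : 0 < r := lt_min one_pos (Real.sqrt_pos.2 (neg_pos.2 ht₀))
  obtain ⟨t, ht, x, -, hM⟩ := hsing r hrpos 0
  have hr2 : r ^ 2 ≤ -t₀ := by
    have h1 : r ≤ Real.sqrt (-t₀) := min_le_right _ _
    have h2 : r ^ 2 ≤ Real.sqrt (-t₀) ^ 2 := pow_le_pow_left₀ hrpos.le h1 2
    rwa [Real.sq_sqrt (neg_nonneg.2 ht₀.le)] at h2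
  have htI : t ∈ Ioo t₀ 0 := ⟨by linarith [ht.1], ht.2⟩
  rw [eq_zero_after_zero_slice hw h0 htI x, norm_zero] at hM
  exact lt_irrefl _ hM

end Summit.NavierStokesRegularity.NavierStokesRegularity.Theorems.FiniteDissipationLiouville.CalmSlice

end
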